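import Summits.AtomisticToContinuum.BoseEinsteinCondensation.Theorems.BECPhaseQuadratureSumRuleCurrentSumRuleAssembly
import Summits.AtomisticToContinuum.BoseEinsteinCondensation.Theorems.BECConjugateDominationPuffFloorEulerLagrange

/-!
# Route `BECPhaseQuadratureSumRule`, support `CurrentSumRule` (stmt-AtomisticToContinuum-12618):
# the current sum rule `m₂² ≤ 4 m₁ M₃` for a `C³` periodic minimiser

Closes stmt-AtomisticToContinuum-12618 (`currentSumRule_proof : CurrentSumRule`). For the smooth
class of pair profiles `v` (finite, `ṽ(x) = v(|x|) ∈ C²`, range `R₀`), `t ∈ (0,1]`, a torus of side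
`L > 2R₀`, an exact `C³` finite-energy minimiser `Ψ` of the periodic `N`-body energy of
`w = t·v` and a mode `k = 2πn/L`:

  `m₂² ≤ 4 · (N|k|²) · (12|k|² ∑ⱼ‖(k·∇ⱼ)Ψ‖² + N|k|⁶ + 4 E_Ψ[∑_{i<j}(1 - cos k·x_{ij}) |∂_k²w^per(x_{ij})|])`,

`m₂ = ‖A_kΨ‖²`, `A_k = [H, ρ_k†] = ∑ⱼ e^{ik·xⱼ}(-2ik·∇ⱼ + |k|²)`. Proof (variational, no spectral
theory): the Euler–Lagrange equation of the minimiser (`stub_eulerLagrange`) makes `u₁ = Re Ψ` and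
`u₂ = Im Ψ` real solutions of `-Δu + Vu = E₀u`; the shifted form `q(φ) = ⟨φ,(H - E₀)φ⟩ ≥ 0` on the
Bose class (variational principle) gives Cauchy–Schwarz `m₂² = b(A_kΨ, ρ_k†Ψ)² ≤ q(ρ_k†Ψ) q(A_kΨ)`
(`(H-E₀)ρ_k†Ψ = A_kΨ`, Green); the parallelogram bound `q(φ₁ + iφ₂) ≤ 2q(φ₁) + 2q(φ₂)` and the
real engine (f-sum rule `q(ρ_k u) = Nκ∫u²`, Puff's cubic moment
`q(A_ku) = Nκ³∫u² + 12κ∫∑(∂ⱼu)² + 2Re∫u²∑eⱼēₗ∂ₗ∂ⱼV`, phase sum) give `q(ρ_k†Ψ) ≤ 2Nκ` and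
`q(A_kΨ) ≤ 2M₃`, whence the factor `4`.

References: R. D. Puff, Phys. Rev. 137 (1965) A406; S. Stringari, in *Bose–Einstein Condensation*
(CUP 1995) §2.3 (19)–(23); L. Pitaevskii, S. Stringari, J. Low Temp. Phys. 85 (1991) 377;
H. Wagner, Z. Physik 195 (1966) 273.
-/

noncomputable section

namespace Summit.AtomisticToContinuum.BoseEinsteinCondensation.Theorems

open MeasureTheory
open scoped ENNReal NNReal BigOperators ComplexConjugate
open Literature.MathematicalPhysics.QuantumManyBody.BoseGas

namespace CurrentSumRule

variable {N : ℕ} {L : ℝ}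

/-- **The current sum rule in real form.** For a complex `C³` lattice-periodic Bose-symmetric
solution `Ψ` of `-ΔΨ + VΨ = EΨ` on the torus, `V = ∑_{a<b}w^per(x_{ab})` (finite `w` of range `R₀`,
`2R₀ < L`, `w̃ ∈ C²`), such that the shifted form `q(φ) = ∫(|∇φ|² + (V - E)|φ|²)` is non-negative on
the admissible class (e.g. `E` the ground-state energy), and a mode `m` (`k = 2πm/L`, `κ = ‖k‖²`):
`m₂² ≤ 4·(Nκ‖Ψ‖²)·(12κT + Nκ³‖Ψ‖² + 4P)` with `m₂ = ∫|A_kΨ|²`, `T = ∑ⱼ∫|∂ⱼΨ|²`,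
`P = ∫ Φ|Ψ|²`, `Φ = ∑_{a<b}(1 - cos k·x_{ab})|∂_k∂_kw^per(x_{ab})|`. [cite: Stringari1995, §2.3 (19)–(23)] -/
theorem sumRule_real {w : ℝ → ℝ≥0∞} {R₀ : ℝ} (hw : ∀ r, R₀ < r → w r = 0) (h2R : 2 * R₀ < L)
    (hL : 0 < L) (hwfin : ∀ r, w r ≠ ⊤) (hwC2 : ContDiff ℝ 2 (fun x : Space => (w ‖x‖).toReal))
    (m : Fin 3 → ℤ) {k : Space} (hk : k = (2 * Real.pi / L) • latticeVec 1 m)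
    {ψ : Config N → ℂ} (hψ3 : ContDiff ℝ 3 ψ)
    (hψper : ∀ (X : Config N) (i : Fin N) (c : Fin 3), ψ (X + Pi.single i (EuclideanSpace.single c L)) = ψ X)
    (hψsymm : ∀ (σ : Equiv.Perm (Fin N)) (X : Config N), ψ (X ∘ σ) = ψ X) {E : ℝ}
    (hEL : ∀ X : Config N, -(∑ i : Fin N, ∑ a : Fin 3,
        fderiv ℝ (fun Y : Config N => fderiv ℝ ψ Y (Pi.single i (EuclideanSpace.single a (1 : ℝ)))) X
          (Pi.single i (EuclideanSpace.single a (1 : ℝ)))) + (((periodicInteraction w L X).toReal : ℝ) : ℂ) * ψ X =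
        ((E : ℝ) : ℂ) * ψ X)
    {W : Config N → ℝ} (hWVE : ∀ X, W X = (fun Y : Config N => (periodicInteraction w L Y).toReal) X - E)
    (hnonneg : ∀ φ : Config N → ℂ, ContDiff ℝ 1 φ →
      (∀ (X : Config N) (i : Fin N) (c : Fin 3), φ (X + Pi.single i (EuclideanSpace.single c L)) = φ X) →
      (∀ (σ : Equiv.Perm (Fin N)) (X : Config N), φ (X ∘ σ) = φ X) →
      0 ≤ ∫ X in cellN N L, (kineticDensityReal φ X + W X * ‖φ X‖ ^ 2)) :
    (∫ X in cellN N L, ‖∑ j : Fin N, cellWave L m (X j) *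
        ((-2 * Complex.I) * fderiv ℝ ψ X (Pi.single j k) + (((‖k‖ ^ 2 : ℝ)) : ℂ) * ψ X)‖ ^ 2) ^ 2 ≤
      4 * ((((N : ℝ) * ‖k‖ ^ 2 * ∫ X in cellN N L, ‖ψ X‖ ^ 2)) *
        (12 * ‖k‖ ^ 2 * (∑ j : Fin N, ∫ X in cellN N L, ‖fderiv ℝ ψ X (Pi.single j k)‖ ^ 2) +
          (N : ℝ) * ‖k‖ ^ 6 * (∫ X in cellN N L, ‖ψ X‖ ^ 2) +
          4 * ∫ X in cellN N L, (∑ a : Fin N, ∑ b : Fin N with a < b,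
            (1 - Real.cos (inner ℝ k (X a - X b))) *
              |fderiv ℝ (fun x => fderiv ℝ (fun z => (periodizedPotential w L z).toReal) x k) (X a - X b) k|) *
            ‖ψ X‖ ^ 2)) := by
  -- ### data
  have hV2 : ContDiff ℝ 2 (fun X : Config N => (periodicInteraction w L X).toReal) :=
    contDiff_toReal_periodicInteraction hw h2R hL hwfin hwC2
  have hVper : IsLatticePeriodic L (fun X : Config N => (periodicInteraction w L X).toReal) :=
    fun X i c => by simp only [periodicInteraction_add_single]
  have hWc : Continuous W := by
    have h : W = fun X => (periodicInteraction w L X).toReal - E := funext hWVE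
    rw [h]; exact hV2.continuous.sub continuous_const
  have hψ2 : ContDiff ℝ 2 ψ := hψ3.of_le (by norm_num)
  have hψ1 : ContDiff ℝ 1 ψ := hψ3.of_le (by norm_num)
  have hψd : Differentiable ℝ ψ := hψ1.differentiable one_ne_zero
  have hEq₁ := realEquation_re hψ2 hEL
  have hEq₂ := realEquation_im hψ2 hEL
  -- ### the real amplitudes `u₁ = Re Ψ`, `u₂ = Im Ψ`
  set u₁ : Config N → ℝ := fun X => (ψ X).re with hu₁
  set u₂ : Config N → ℝ := fun X => (ψ X).im with hu₂
  have hu₁3 : ContDiff ℝ 3 u₁ := Complex.reCLM.contDiff.comp hψ3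
  have hu₂3 : ContDiff ℝ 3 u₂ := Complex.imCLM.contDiff.comp hψ3
  have hu₁2 : ContDiff ℝ 2 u₁ := hu₁3.of_le (by norm_num)
  have hu₂2 : ContDiff ℝ 2 u₂ := hu₂3.of_le (by norm_num)
  have hu₁1 : ContDiff ℝ 1 u₁ := hu₁3.of_le (by norm_num)
  have hu₂1 : ContDiff ℝ 1 u₂ := hu₂3.of_le (by norm_num)
  have hu₁per : IsLatticePeriodic L u₁ := fun X i c => by simp only [hu₁, hψper X i c]
  have hu₂per : IsLatticePeriodic L u₂ := fun X i c => by simp only [hu₂, hψper X i c]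
  have hu₁symm : ∀ (σ : Equiv.Perm (Fin N)) (X : Config N), u₁ (X ∘ σ) = u₁ X :=
    fun σ X => by simp only [hu₁, hψsymm σ X]
  have hu₂symm : ∀ (σ : Equiv.Perm (Fin N)) (X : Config N), u₂ (X ∘ σ) = u₂ X :=
    fun σ X => by simp only [hu₂, hψsymm σ X]
  -- ### the test amplitudes
  set Gu₁ : Config N → ℂ := fun X => (∑ j : Fin N, cellWave L m (X j)) * ((u₁ X : ℝ) : ℂ) with hGu₁
  set Gu₂ : Config N → ℂ := fun X => (∑ j : Fin N, cellWave L m (X j)) * ((u₂ X : ℝ) : ℂ) with hGu₂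
  set A₁ : Config N → ℂ := fun X => ∑ j : Fin N, cellWave L m (X j) *
    ((((‖k‖ ^ 2 : ℝ) : ℂ)) * ((u₁ X : ℝ) : ℂ) - 2 * Complex.I * ((fderiv ℝ u₁ X (Pi.single j k) : ℝ) : ℂ)) with hA₁
  set A₂ : Config N → ℂ := fun X => ∑ j : Fin N, cellWave L m (X j) *
    ((((‖k‖ ^ 2 : ℝ) : ℂ)) * ((u₂ X : ℝ) : ℂ) - 2 * Complex.I * ((fderiv ℝ u₂ X (Pi.single j k) : ℝ) : ℂ)) with hA₂
  set Aψ : Config N → ℂ := fun X => ∑ j : Fin N, cellWave L m (X j) *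
    ((-2 * Complex.I) * fderiv ℝ ψ X (Pi.single j k) + (((‖k‖ ^ 2 : ℝ)) : ℂ) * ψ X) with hAψ
  set Gψ : Config N → ℂ := fun X => (∑ j : Fin N, cellWave L m (X j)) * ψ X with hGψ
  have hAψ_eq : ∀ X, Aψ X = A₁ X + Complex.I * A₂ X := fun X => commAmp_re_add_im (hψd X) L m _ k
  have hGψ_eq : ∀ X, Gψ X = Gu₁ X + Complex.I * Gu₂ X := fun X => rhoAmp_re_add_im L m ψ X
  have hAψ_fun : Aψ = fun X => A₁ X + Complex.I * A₂ X := funext hAψ_eq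
  have hGψ_fun : Gψ = fun X => Gu₁ X + Complex.I * Gu₂ X := funext hGψ_eq
  -- admissibility
  have hGu₁3 : ContDiff ℝ 3 Gu₁ := contDiff_rhoAmp L m hu₁3
  have hGu₂3 : ContDiff ℝ 3 Gu₂ := contDiff_rhoAmp L m hu₂3
  have hGu₁1 : ContDiff ℝ 1 Gu₁ := hGu₁3.of_le (by norm_num)
  have hGu₂1 : ContDiff ℝ 1 Gu₂ := hGu₂3.of_le (by norm_num)
  have hGu₁per : ∀ (X : Config N) (i : Fin N) (c : Fin 3), Gu₁ (X + Pi.single i (EuclideanSpace.single c L)) = Gu₁ X :=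
    rhoAmp_periodic L m hL.ne' hu₁per
  have hGu₂per : ∀ (X : Config N) (i : Fin N) (c : Fin 3), Gu₂ (X + Pi.single i (EuclideanSpace.single c L)) = Gu₂ X :=
    rhoAmp_periodic L m hL.ne' hu₂per
  have hGu₁symm : ∀ (σ : Equiv.Perm (Fin N)) (X : Config N), Gu₁ (X ∘ σ) = Gu₁ X := rhoAmp_symm L m hu₁symm
  have hGu₂symm : ∀ (σ : Equiv.Perm (Fin N)) (X : Config N), Gu₂ (X ∘ σ) = Gu₂ X := rhoAmp_symm L m hu₂symm
  have hA₁2 : ContDiff ℝ 2 A₁ := contDiff_commAmp L m hu₁3 _ k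
  have hA₂2 : ContDiff ℝ 2 A₂ := contDiff_commAmp L m hu₂3 _ k
  have hA₁1 : ContDiff ℝ 1 A₁ := hA₁2.of_le (by norm_num)
  have hA₂1 : ContDiff ℝ 1 A₂ := hA₂2.of_le (by norm_num)
  have hA₁per : ∀ (X : Config N) (i : Fin N) (c : Fin 3), A₁ (X + Pi.single i (EuclideanSpace.single c L)) = A₁ X :=
    commAmp_periodic L m hL.ne' hu₁per _ k
  have hA₂per : ∀ (X : Config N) (i : Fin N) (c : Fin 3), A₂ (X + Pi.single i (EuclideanSpace.single c L)) = A₂ X :=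
    commAmp_periodic L m hL.ne' hu₂per _ k
  have hA₁symm : ∀ (σ : Equiv.Perm (Fin N)) (X : Config N), A₁ (X ∘ σ) = A₁ X := commAmp_symm L m hu₁1 hu₁symm _ k
  have hA₂symm : ∀ (σ : Equiv.Perm (Fin N)) (X : Config N), A₂ (X ∘ σ) = A₂ X := commAmp_symm L m hu₂1 hu₂symm _ k
  have hGψ2 : ContDiff ℝ 2 Gψ := (ContDiff.sum fun j _ => contDiff_cellWave_comp_apply L m j).mul hψ2
  have hGψ1 : ContDiff ℝ 1 Gψ := hGψ2.of_le (by norm_num)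
  have hAψ1 : ContDiff ℝ 1 Aψ := by rw [hAψ_fun]; exact hA₁1.add (contDiff_const.mul hA₂1)
  have hGψper : ∀ (X : Config N) (i : Fin N) (c : Fin 3), Gψ (X + Pi.single i (EuclideanSpace.single c L)) = Gψ X :=
    fun X i c => by rw [hGψ_eq, hGψ_eq X, hGu₁per X i c, hGu₂per X i c]
  have hAψper : ∀ (X : Config N) (i : Fin N) (c : Fin 3), Aψ (X + Pi.single i (EuclideanSpace.single c L)) = Aψ X :=
    fun X i c => by rw [hAψ_eq, hAψ_eq X, hA₁per X i c, hA₂per X i c]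
  have hGψsymm : ∀ (σ : Equiv.Perm (Fin N)) (X : Config N), Gψ (X ∘ σ) = Gψ X :=
    fun σ X => by rw [hGψ_eq, hGψ_eq X, hGu₁symm σ X, hGu₂symm σ X]
  have hAψsymm : ∀ (σ : Equiv.Perm (Fin N)) (X : Config N), Aψ (X ∘ σ) = Aψ X :=
    fun σ X => by rw [hAψ_eq, hAψ_eq X, hA₁symm σ X, hA₂symm σ X]
  -- ### the numbers of the real engine
  have hqG₁ := form_rhoAmp m hL hk hu₁2 hu₁per hV2.continuous hWVE hEq₁
  have hqG₂ := form_rhoAmp m hL hk hu₂2 hu₂per hV2.continuous hWVE hEq₂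
  have hqA₁ := form_commAmp m hL hk hu₁3 hu₁per hV2 hVper hWVE hEq₁
  have hqA₂ := form_commAmp m hL hk hu₂3 hu₂per hV2 hVper hWVE hEq₂
  have hP₁ := re_integral_sq_mul_phaseHessian_le (N := N) m hw h2R hL hwfin hwC2 hk hu₁1.continuous
  have hP₂ := re_integral_sq_mul_phaseHessian_le (N := N) m hw h2R hL hwfin hwC2 hk hu₂1.continuous
  -- ### the parallelogram bounds
  have hqG : ∫ X in cellN N L, (kineticDensityReal Gψ X + W X * ‖Gψ X‖ ^ 2) ≤
      2 * (∫ X in cellN N L, (kineticDensityReal Gu₁ X + W X * ‖Gu₁ X‖ ^ 2)) +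
        2 * ∫ X in cellN N L, (kineticDensityReal Gu₂ X + W X * ‖Gu₂ X‖ ^ 2) := by
    have h := form_add_le hWc hnonneg (φ := Gu₁) (η := fun X => Complex.I * Gu₂ X) hGu₁1
      (contDiff_const.mul hGu₂1) hGu₁per (fun X i c => by rw [hGu₂per X i c]) hGu₁symm
      (fun σ X => by rw [hGu₂symm σ X])
    rw [form_I_mul W (hGu₂1.differentiable one_ne_zero)] at h
    rw [hGψ_fun]
    exact h
  have hqA : ∫ X in cellN N L, (kineticDensityReal Aψ X + W X * ‖Aψ X‖ ^ 2) ≤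
      2 * (∫ X in cellN N L, (kineticDensityReal A₁ X + W X * ‖A₁ X‖ ^ 2)) +
        2 * ∫ X in cellN N L, (kineticDensityReal A₂ X + W X * ‖A₂ X‖ ^ 2) := by
    have h := form_add_le hWc hnonneg (φ := A₁) (η := fun X => Complex.I * A₂ X) hA₁1
      (contDiff_const.mul hA₂1) hA₁per (fun X i c => by rw [hA₂per X i c]) hA₁symm
      (fun σ X => by rw [hA₂symm σ X])
    rw [form_I_mul W (hA₂1.differentiable one_ne_zero)] at h
    rw [hAψ_fun]
    exact h
  -- ### the cross pairing `b(Aψ, Gψ) = ‖Aψ‖² = m₂` and Cauchy–Schwarz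
  have hHG : ∀ X : Config N, -(∑ i : Fin N, ∑ a : Fin 3, fderiv ℝ (fun Y => fderiv ℝ Gψ Y
      (Pi.single i (EuclideanSpace.single a (1 : ℝ)))) X (Pi.single i (EuclideanSpace.single a (1 : ℝ)))) +
        ((W X : ℝ) : ℂ) * Gψ X = Aψ X :=
    shiftedLaplacian_rhoAmp hψ2 m hk hEL hWVE
  have hcross : ∫ X in cellN N L, ((∑ i : Fin N, ∑ a : Fin 3,
      (conj (fderiv ℝ Aψ X (Pi.single i (EuclideanSpace.single a (1 : ℝ)))) *
        fderiv ℝ Gψ X (Pi.single i (EuclideanSpace.single a (1 : ℝ)))).re) + W X * (conj (Aψ X) * Gψ X).re) =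
      ∫ X in cellN N L, ‖Aψ X‖ ^ 2 := by
    rw [form_pairing_eq_re_integral hL hWc hAψ1 hGψ2 hAψper hGψper]
    simp_rw [hHG]
    exact re_integral_conj_mul_self hAψ1.continuous L
  have hCS := sq_formPairing_le_of_nonneg hWc hnonneg hGψ1 hAψ1 hGψper hAψper hGψsymm hAψsymm
  rw [hcross] at hCS
  -- ### book-keeping of the real parts
  have hnorm : (∫ X in cellN N L, u₁ X ^ 2) + ∫ X in cellN N L, u₂ X ^ 2 = ∫ X in cellN N L, ‖ψ X‖ ^ 2 := by
    rw [← integral_add (integrableOn_cellN (f := fun X => u₁ X ^ 2) (hu₁1.continuous.pow 2) L)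
      (integrableOn_cellN (f := fun X => u₂ X ^ 2) (hu₂1.continuous.pow 2) L)]
    refine integral_congr_ae (ae_of_all _ fun X => ?_)
    show (ψ X).re ^ 2 + (ψ X).im ^ 2 = ‖ψ X‖ ^ 2
    rw [Complex.sq_norm, Complex.normSq_apply]
    ring
  have hkin : (∫ X in cellN N L, ∑ j : Fin N, fderiv ℝ u₁ X (Pi.single j k) ^ 2) +
      (∫ X in cellN N L, ∑ j : Fin N, fderiv ℝ u₂ X (Pi.single j k) ^ 2) =
      ∑ j : Fin N, ∫ X in cellN N L, ‖fderiv ℝ ψ X (Pi.single j k)‖ ^ 2 := by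
    have hc₁ : Continuous fun X => ∑ j : Fin N, fderiv ℝ u₁ X (Pi.single j k) ^ 2 :=
      continuous_finsetSum _ fun j _ => (continuous_fderiv_apply_const hu₁1 _).pow 2
    have hc₂ : Continuous fun X => ∑ j : Fin N, fderiv ℝ u₂ X (Pi.single j k) ^ 2 :=
      continuous_finsetSum _ fun j _ => (continuous_fderiv_apply_const hu₂1 _).pow 2
    have hc : ∀ j : Fin N, Continuous fun X => ‖fderiv ℝ ψ X (Pi.single j k)‖ ^ 2 := fun j =>
      (continuous_fderiv_apply_const hψ1 _).norm.pow 2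
    rw [← integral_add (integrableOn_cellN hc₁ L) (integrableOn_cellN hc₂ L),
      ← integral_finsetSum _ (f := fun j X => ‖fderiv ℝ ψ X (Pi.single j k)‖ ^ 2)
        fun j _ => integrableOn_cellN (hc j) L]
    refine integral_congr_ae (ae_of_all _ fun X => ?_)
    dsimp only
    rw [← Finset.sum_add_distrib]
    exact Finset.sum_congr rfl fun j _ => (norm_fderiv_sq_eq (hψd X) _).symm
  set Φ : Config N → ℝ := fun X => ∑ a : Fin N, ∑ b : Fin N with a < b,
    (1 - Real.cos (inner ℝ k (X a - X b))) *
      |fderiv ℝ (fun x => fderiv ℝ (fun z => (periodizedPotential w L z).toReal) x k) (X a - X b) k| with hΦ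
  have hΦc : Continuous Φ := continuous_phaseHessianWeight (N := N) k hw h2R hL hwC2
  have hpot : (∫ X in cellN N L, u₁ X ^ 2 * Φ X) + (∫ X in cellN N L, u₂ X ^ 2 * Φ X) =
      ∫ X in cellN N L, Φ X * ‖ψ X‖ ^ 2 := by
    rw [← integral_add (integrableOn_cellN (f := fun X => u₁ X ^ 2 * Φ X) ((hu₁1.continuous.pow 2).mul hΦc) L)
      (integrableOn_cellN (f := fun X => u₂ X ^ 2 * Φ X) ((hu₂1.continuous.pow 2).mul hΦc) L)]
    refine integral_congr_ae (ae_of_all _ fun X => ?_)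
    show (ψ X).re ^ 2 * Φ X + (ψ X).im ^ 2 * Φ X = Φ X * ‖ψ X‖ ^ 2
    rw [Complex.sq_norm, Complex.normSq_apply]
    ring
  -- ### the algebra
  have hq₀A := hnonneg Aψ hAψ1 hAψper hAψsymm
  exact sumRule_algebra (sq_nonneg ‖k‖) (by positivity) (integral_nonneg fun X => sq_nonneg _) hq₀A hqG₁ hqG₂
    hqA₁ hqA₂ hP₁ hP₂ hnorm hkin hpot hqG hqA hCS

/-- **The current sum rule for `n + 1` particles** in the `ℝ≥0∞` form of the item (all data
explicit; `w = t·v`, exact minimiser). [cite: Stringari1995, §2.3 (19)–(23)] -/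
theorem sumRule_succ (v : ℝ → ℝ≥0∞) (hv : IsRepulsiveFiniteRange v) (hfin : ∀ r, v r ≠ ⊤)
    (hC2 : ContDiff ℝ 2 (fun x : Space => (v ‖x‖).toReal)) (R₀ : ℝ) (hR₀ : 0 < R₀)
    (hrange : ∀ r, R₀ < r → v r = 0) (t : ℝ) (ht0 : 0 < t) (n : ℕ) (L : ℝ) (h2R : 2 * R₀ < L)
    (Ψ : PeriodicTrialState (n + 1) L) (hC3 : ContDiff ℝ 3 Ψ.ψ)
    (hmin : periodicEnergy (fun r => ENNReal.ofReal t * v r) Ψ =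
      periodicGroundStateEnergy (fun r => ENNReal.ofReal t * v r) (n + 1) L)
    (hfinE : periodicEnergy (fun r => ENNReal.ofReal t * v r) Ψ ≠ ⊤) (m : Fin 3 → ℤ) :
    (∫⁻ X in cellN (n + 1) L, (‖∑ j : Fin (n + 1), cellWave L m (X j) *
        ((-2 * Complex.I) * fderiv ℝ Ψ.ψ X (Pi.single j ((2 * Real.pi / L) • latticeVec 1 m)) +
          (((‖((2 * Real.pi / L) • latticeVec 1 m)‖ ^ 2 : ℝ)) : ℂ) * Ψ.ψ X)‖₊ : ENNReal) ^ 2) ^ 2 ≤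
      4 * (ENNReal.ofReal (((n + 1 : ℕ) : ℝ) * ‖((2 * Real.pi / L) • latticeVec 1 m)‖ ^ 2) *
        (ENNReal.ofReal (12 * ‖((2 * Real.pi / L) • latticeVec 1 m)‖ ^ 2) *
            (∑ j : Fin (n + 1), ∫⁻ X in cellN (n + 1) L,
              (‖fderiv ℝ Ψ.ψ X (Pi.single j ((2 * Real.pi / L) • latticeVec 1 m))‖₊ : ENNReal) ^ 2) +
          ENNReal.ofReal (((n + 1 : ℕ) : ℝ) * ‖((2 * Real.pi / L) • latticeVec 1 m)‖ ^ 6) +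
          4 * ∫⁻ X in cellN (n + 1) L, (∑ i : Fin (n + 1), ∑ j : Fin (n + 1) with i < j,
            ENNReal.ofReal ((1 - Real.cos (inner ℝ ((2 * Real.pi / L) • latticeVec 1 m) (X i - X j))) *
              |fderiv ℝ (fun z : Space => fderiv ℝ (fun z : Space =>
                ∑' m : Fin 3 → ℤ, t * (v ‖z - latticeVec L m‖).toReal) z ((2 * Real.pi / L) • latticeVec 1 m))
                  (X i - X j) ((2 * Real.pi / L) • latticeVec 1 m)|)) * (‖Ψ.ψ X‖₊ : ENNReal) ^ 2)) := by
  set k : Space := (2 * Real.pi / L) • latticeVec 1 m with hk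
  set w : ℝ → ℝ≥0∞ := fun r => ENNReal.ofReal t * v r with hw
  have hL : 0 < L := by linarith
  -- ### the scaled profile `w = t v`
  have hwfin : ∀ r, w r ≠ ⊤ := fun r => ENNReal.mul_ne_top ENNReal.ofReal_ne_top (hfin r)
  have hwrange : ∀ r, R₀ < r → w r = 0 := fun r hr => by simp only [hw, hrange r hr, mul_zero]
  have hwrep : IsRepulsiveFiniteRange w := ⟨measurable_const.mul hv.1, R₀, hwrange⟩
  have hwtoReal : ∀ r, (w r).toReal = t * (v r).toReal := fun r => by
    simp only [hw, ENNReal.toReal_mul, ENNReal.toReal_ofReal ht0.le]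
  have hwC2 : ContDiff ℝ 2 (fun x : Space => (w ‖x‖).toReal) := by
    have h : (fun x : Space => (w ‖x‖).toReal) = fun x => t * (v ‖x‖).toReal := funext fun x => hwtoReal _
    rw [h]
    exact contDiff_const.mul hC2
  -- the Hessian profile of the item is that of `w^per`
  have hHf : (fun z : Space => ∑' m : Fin 3 → ℤ, t * (v ‖z - latticeVec L m‖).toReal) =
      fun z => (periodizedPotential w L z).toReal := by
    funext z
    rw [periodizedPotential, ENNReal.tsum_toReal_eq fun _ => hwfin _]
    exact tsum_congr fun _ => (hwtoReal _).symm
  rw [hHf]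
  -- ### the Euler–Lagrange equation and the variational principle
  have hV2 : ContDiff ℝ 2 (fun X : Config (n + 1) => (periodicInteraction w L X).toReal) :=
    contDiff_toReal_periodicInteraction hwrange h2R hL hwfin hwC2
  have hVW : ∀ X : Config (n + 1), periodicInteraction w L X =
      ENNReal.ofReal ((fun X : Config (n + 1) => (periodicInteraction w L X).toReal) X) :=
    periodicInteraction_eq_ofReal_toReal hwrange h2R hL hwfin
  have hEfin : periodicGroundStateEnergy w (n + 1) L ≠ ⊤ := hmin ▸ hfinE
  have hEL := stub_eulerLagrange w hwrep hwfin hwC2 R₀ hR₀ hwrange n L hL h2R Ψ hC3 hmin hfinE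
  set E₀ : ℝ := (periodicGroundStateEnergy w (n + 1) L).toReal with hE₀
  set W : Config (n + 1) → ℝ := fun X => (periodicInteraction w L X).toReal - E₀ with hWdef
  have hWVE : ∀ X, W X = (fun X : Config (n + 1) => (periodicInteraction w L X).toReal) X - E₀ := fun X => rfl
  have hnonneg : ∀ φ : Config (n + 1) → ℂ, ContDiff ℝ 1 φ →
      (∀ (X : Config (n + 1)) (i : Fin (n + 1)) (c : Fin 3), φ (X + Pi.single i (EuclideanSpace.single c L)) = φ X) →
      (∀ (σ : Equiv.Perm (Fin (n + 1))) (X : Config (n + 1)), φ (X ∘ σ) = φ X) →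
      0 ≤ ∫ X in cellN (n + 1) L, (kineticDensityReal φ X + W X * ‖φ X‖ ^ 2) := by
    intro φ hφ hper hsymm
    have h := toReal_periodicGroundStateEnergy_mul_le hφ hper hsymm hV2.continuous
      (fun _ => ENNReal.toReal_nonneg) hVW hEfin
    have i1 : IntegrableOn (fun X => kineticDensityReal φ X + (periodicInteraction w L X).toReal * ‖φ X‖ ^ 2)
        (cellN (n + 1) L) :=
      integrableOn_cellN ((continuous_kineticDensityReal hφ).add (hV2.continuous.mul (hφ.continuous.norm.pow 2))) L
    have i2 : IntegrableOn (fun X => E₀ * ‖φ X‖ ^ 2) (cellN (n + 1) L) :=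
      integrableOn_cellN (continuous_const.mul (hφ.continuous.norm.pow 2)) L
    have heq : ∀ X, kineticDensityReal φ X + W X * ‖φ X‖ ^ 2 =
        (kineticDensityReal φ X + (periodicInteraction w L X).toReal * ‖φ X‖ ^ 2) - E₀ * ‖φ X‖ ^ 2 := fun X => by
      simp only [hWdef]; ring
    simp_rw [heq]
    rw [integral_sub i1 i2, integral_const_mul]
    linarith
  -- ### the real inequality
  have hreal := sumRule_real hwrange h2R hL hwfin hwC2 m hk hC3 Ψ.periodic Ψ.symm hEL hWVE hnonneg
  -- normalisation
  have hone : ∫ X in cellN (n + 1) L, ‖Ψ.ψ X‖ ^ 2 = 1 := by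
    have h := lintegral_cellN_nnnorm_sq_eq_ofReal_integral Ψ.contDiff.continuous L
    rw [Ψ.norm_eq] at h
    have hnn : 0 ≤ ∫ X in cellN (n + 1) L, ‖Ψ.ψ X‖ ^ 2 := integral_nonneg fun X => sq_nonneg _
    have := congrArg ENNReal.toReal h
    rwa [ENNReal.toReal_ofReal hnn, ENNReal.toReal_one, eq_comm] at this
  rw [hone, mul_one, mul_one] at hreal
  -- ### back to `ℝ≥0∞`
  have hAc : Continuous fun X : Config (n + 1) => ∑ j : Fin (n + 1), cellWave L m (X j) *
      ((-2 * Complex.I) * fderiv ℝ Ψ.ψ X (Pi.single j k) + (((‖k‖ ^ 2 : ℝ)) : ℂ) * Ψ.ψ X) := by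
    refine continuous_finsetSum _ fun j _ => ?_
    have h1 : Continuous fun X : Config (n + 1) => cellWave L m (X j) :=
      (contDiff_cellWave L m).continuous.comp (continuous_apply j)
    have h2 := continuous_fderiv_apply_const Ψ.contDiff (Pi.single j k)
    have h3 := Ψ.contDiff.continuous
    fun_prop
  have hTj : ∀ j : Fin (n + 1), ∫⁻ X in cellN (n + 1) L, ((‖fderiv ℝ Ψ.ψ X (Pi.single j k)‖₊ : ℝ≥0∞)) ^ 2 =
      ENNReal.ofReal (∫ X in cellN (n + 1) L, ‖fderiv ℝ Ψ.ψ X (Pi.single j k)‖ ^ 2) := fun j =>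
    lintegral_cellN_nnnorm_sq_eq_ofReal_integral (continuous_fderiv_apply_const Ψ.contDiff _) L
  simp_rw [hTj]
  rw [lintegral_cellN_nnnorm_sq_eq_ofReal_integral hAc, lintegral_phaseHessianWeight_eq k hwrange h2R hL hwC2
      Ψ.contDiff.continuous, ← ENNReal.ofReal_sum_of_nonneg fun j _ => integral_nonneg fun X => sq_nonneg _]
  set T : ℝ := ∑ j : Fin (n + 1), ∫ X in cellN (n + 1) L, ‖fderiv ℝ Ψ.ψ X (Pi.single j k)‖ ^ 2 with hT
  set P : ℝ := ∫ X in cellN (n + 1) L, (∑ a : Fin (n + 1), ∑ b : Fin (n + 1) with a < b,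
    (1 - Real.cos (inner ℝ k (X a - X b))) *
      |fderiv ℝ (fun x => fderiv ℝ (fun z => (periodizedPotential w L z).toReal) x k) (X a - X b) k|) *
        ‖Ψ.ψ X‖ ^ 2 with hP
  set m₂ : ℝ := ∫ X in cellN (n + 1) L, ‖∑ j : Fin (n + 1), cellWave L m (X j) *
      ((-2 * Complex.I) * fderiv ℝ Ψ.ψ X (Pi.single j k) + (((‖k‖ ^ 2 : ℝ)) : ℂ) * Ψ.ψ X)‖ ^ 2 with hm₂
  have hT0 : 0 ≤ T := Finset.sum_nonneg fun j _ => integral_nonneg fun X => sq_nonneg _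
  have hP0 : 0 ≤ P := integral_nonneg fun X => mul_nonneg (phaseHessianWeight_nonneg k
    (fun y => fderiv ℝ (fun x => fderiv ℝ (fun z => (periodizedPotential w L z).toReal) x k) y k) X) (sq_nonneg _)
  have hm₂0 : 0 ≤ m₂ := integral_nonneg fun X => sq_nonneg _
  rw [← ENNReal.ofReal_pow hm₂0, ← ofReal_four_mul (((n + 1 : ℕ) : ℝ) * ‖k‖ ^ 2) (12 * ‖k‖ ^ 2) T
    (((n + 1 : ℕ) : ℝ) * ‖k‖ ^ 6) P (by positivity) (by positivity) hT0 (by positivity) hP0]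
  exact ENNReal.ofReal_le_ofReal hreal

end CurrentSumRule

open CurrentSumRule in
/-- **`CurrentSumRule` (stmt-AtomisticToContinuum-12618), the sum-rule engine of route
`BECPhaseQuadratureSumRule`.** For the smooth class (`v` finite, `ṽ ∈ C²`, range `R₀`), `t ∈ (0,1]`,
`2R₀ < L` and every `C³` periodic finite-energy minimiser `Ψ` of `-∑Δ + t∑v^per`, for every
`k = 2πn/L ≠ 0`: `m₂² ≤ 4·m₁·M₃` with `m₂ = ‖∑ⱼe^{ik·xⱼ}(-2ik·∇ⱼ + |k|²)Ψ‖²`, `m₁ = N|k|²`,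
`M₃ = 12|k|²∑ⱼ‖(k·∇ⱼ)Ψ‖² + N|k|⁶ + 4E_Ψ[∑_{i<j}(1 - cos k·x_{ij})|(k·∇)²(tṽ^per)(x_{ij})|]`
(`sumRule_succ`; `N = 0` is trivial). The edge condition and `t ≤ 1`, `n ≠ 0` are not used.
[cite: Stringari1995, §2.3 (19)–(23); Puff1965; PitaevskiiStringari1991; Wagner1966] -/
theorem currentSumRule_proof :
    Summit.AtomisticToContinuum.BoseEinsteinCondensation.Theses.BECPhaseQuadratureSumRule.CurrentSumRule := by
  unfold Summit.AtomisticToContinuum.BoseEinsteinCondensation.Theses.BECPhaseQuadratureSumRule.CurrentSumRule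
  intro v hv hfin hC2 _ R₀ hR₀ hrange t ht0 _ N L h2R Ψ hC3 w hmin hfinE m _
  cases N with
  | zero => simp
  | succ n => exact sumRule_succ v hv hfin hC2 R₀ hR₀ hrange t ht0 n L h2R Ψ hC3 hmin hfinE m

end Summit.AtomisticToContinuum.BoseEinsteinCondensation.Theorems

end
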